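import Mathlib.Algebra.BigOperators.Group.Finset.Basic
import Mathlib.Tactic
import Summits.KontsevichZagierPeriods.Zeta5Search.SymmetricFamilyInnerSum
import HarnessLib

/-!
# ζ(5) search — CONJECTURE D-exact on the diagonal, K1 certificate replay (1/2): the common `k`-recurrence (cell `pub-zeta5`, P2 g6)

HONEST FRAMING: systematic search; no irrationality claim unless certified.  Identities between finite binomial sums of natural
numbers; nothing about the arithmetic of ζ(5); no record moves.

First half of the kernel proof of fam-tele g10's single-sum identity `SingleSumIdentity`
(`Zeta5Search/DexactDiagonalWhipple.lean`: `C(n+k,n)·S_A(n,k) = C(n,k)·S_B(n,k)`, `0 ≤ k ≤ n`), replaying the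
creative-telescoping certificates of `HOME/pub-zeta5-fam-tele/g10/k1cert/` (fam-tele g10, shared `exactrec.telescoping` 0.1.4,
countersigned by eng-exactrec-1; engines REQUESTS L2146/L2148/L2149, RULINGS R-344(b2)):

* `uTerm`/`uSum` — `U(n,k) = C(n+k,n)·S_A(n,k)` with a truncation-safe summand
  `u(n,k,j) = C(n+k,k)C(n,j)C(n+k,k+j)C(2n−j,n)C(2n−j,n+k)`; ratio identities `uTerm_k_succ`, `uTerm_j_succ`; certificate (C1)
  in the content-free normalisation `G_A = j(n+1)(j−2n−1)²(k+n+1)/(j+k+1)·u` (`certA_term`) gives the recurrence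
  **`uSum_rec`**: `p₀U(k) + p₁U(k+1) + p₂U(k+2) = 0` (`n ≥ 1`), `p₀ = (k−n)(k+n+1)³`, `p₁ = (k+1)·e₁(n,k)`, `p₂ = (k+1)(k+2)(k+n+2)²`;
* `vVal` — `V(n,k) = C(n,k)·T(n,k)` with `T = SymmetricRecursion.innerT` (the inner sum of Brown–Zudilin's (7), `= S_B(n,k)`); the
  SAME recurrence **`vVal_rec`** follows from the tree's relation (K) `SymmetricRecursion.relK` — no new certificate;
* the free zeros `uSum_above`, `vVal_above` (`k > n`) and the `U`-anchor `uSum_diag : U(n,n) = C(2n,n)³`.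
The anchor `V(n,n) = C(2n,n)³`, the downward induction and `singleSumIdentity_holds` are in `DexactDiagonalK1.lean` (2/2).
Standard axioms only.
-/

namespace Summit.KontsevichZagierPeriods.Zeta5Search.DexactDiagonalWhipple

open Finset
open Summit.KontsevichZagierPeriods.Zeta5Search.SymmetricRecursion
  (innerTerm innerT innerTerm_succ_self e₁ relK choose_succ_left_cast choose_succ_right_cast)

/-! ### The `U` side: truncation-safe summand, ratio identities, certificate (C1) -/

/-- Truncation-safe summand of `U(n,k) = C(n+k,n)·S_A(n,k)`:
`u(n,k,j) = C(n+k,k)·C(n,j)·C(n+k,k+j)·C(2n−j,n)·C(2n−j,n+k)` (equals `C(n+k,n)` times the summand of `SA n k` for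
`j ≤ n − k`, and vanishes for `j > n − k`). -/
def uTerm (n k j : ℕ) : ℚ :=
  (((n + k).choose k : ℕ) : ℚ) * ((n.choose j : ℕ) : ℚ) * (((n + k).choose (k + j) : ℕ) : ℚ) *
    (((2 * n - j).choose n : ℕ) : ℚ) * (((2 * n - j).choose (n + k) : ℕ) : ℚ)

/-- `U(n,k) = Σ_{j ≤ n} u(n,k,j)`. -/
def uSum (n k : ℕ) : ℚ := ∑ j ∈ range (n + 1), uTerm n k j

/-- Shift in `k`: `u(n,k+1,j)·(k+1)(k+j+1)(n+k+1) = u(n,k,j)·(n+k+1)²(n−k−j)` (for `j ≤ 2n`). -/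
theorem uTerm_k_succ (n k j : ℕ) (hj : j ≤ 2 * n) :
    uTerm n (k + 1) j * (((k : ℚ) + 1) * ((k : ℚ) + j + 1) * ((n : ℚ) + k + 1)) =
      uTerm n k j * (((n : ℚ) + k + 1) ^ 2 * ((n : ℚ) - k - j)) := by
  have ha : ((((n + k) : ℕ) : ℚ) + 1) * (((n + k).choose k : ℕ) : ℚ) =
      (((n + k + 1).choose (k + 1) : ℕ) : ℚ) * ((k : ℚ) + 1) := by
    exact_mod_cast Nat.add_one_mul_choose_eq (n + k) k
  have hc : ((((n + k) : ℕ) : ℚ) + 1) * (((n + k).choose (k + j) : ℕ) : ℚ) =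
      (((n + k + 1).choose (k + j + 1) : ℕ) : ℚ) * (((k + j : ℕ) : ℚ) + 1) := by
    exact_mod_cast Nat.add_one_mul_choose_eq (n + k) (k + j)
  have he := choose_succ_right_cast (2 * n - j) (n + k)
  rw [Nat.cast_sub hj] at he
  unfold uTerm
  rw [show n + (k + 1) = n + k + 1 by ring, show k + 1 + j = k + j + 1 by ring, show n + k + 1 = (n + k) + 1 from rfl]
  push_cast at ha hc he ⊢
  set a := (((n + k).choose k : ℕ) : ℚ)
  set a' := (((n + k + 1).choose (k + 1) : ℕ) : ℚ)
  set b := ((n.choose j : ℕ) : ℚ)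
  set c := (((n + k).choose (k + j) : ℕ) : ℚ)
  set c' := (((n + k + 1).choose (k + j + 1) : ℕ) : ℚ)
  set d := (((2 * n - j).choose n : ℕ) : ℚ)
  set e := (((2 * n - j).choose (n + k) : ℕ) : ℚ)
  set e' := (((2 * n - j).choose (n + k + 1) : ℕ) : ℚ)
  linear_combination (b * d * (c' * ((k : ℚ) + j + 1)) * (e' * ((n : ℚ) + k + 1))) * (-ha) +
    (b * d * (a * ((n : ℚ) + k + 1)) * (e' * ((n : ℚ) + k + 1))) * (-hc) +
    (b * d * (a * ((n : ℚ) + k + 1)) * (c * ((n : ℚ) + k + 1))) * he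

/-- Shift in `j`: `u(n,k,j+1)·(j+1)(k+j+1)(2n−j)² = u(n,k,j)·(n−j)³(n−k−j)` (for `j + 1 ≤ 2n`). -/
theorem uTerm_j_succ (n k j : ℕ) (hj : j + 1 ≤ 2 * n) :
    uTerm n k (j + 1) * (((j : ℚ) + 1) * ((k : ℚ) + j + 1) * (2 * (n : ℚ) - j) ^ 2) =
      uTerm n k j * (((n : ℚ) - j) ^ 3 * ((n : ℚ) - k - j)) := by
  have hb := choose_succ_right_cast n j
  have hc := choose_succ_right_cast (n + k) (k + j)
  have hd := choose_succ_left_cast (2 * n - (j + 1)) n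
  have he := choose_succ_left_cast (2 * n - (j + 1)) (n + k)
  have h1 : 2 * n - (j + 1) + 1 = 2 * n - j := by omega
  rw [h1, Nat.cast_sub (by omega : j + 1 ≤ 2 * n)] at hd he
  unfold uTerm
  rw [show k + (j + 1) = k + j + 1 by ring]
  push_cast at hb hc hd he ⊢
  set a := (((n + k).choose k : ℕ) : ℚ)
  set b := ((n.choose j : ℕ) : ℚ)
  set b' := ((n.choose (j + 1) : ℕ) : ℚ)
  set c := (((n + k).choose (k + j) : ℕ) : ℚ)
  set c' := (((n + k).choose (k + j + 1) : ℕ) : ℚ)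
  set d := (((2 * n - j).choose n : ℕ) : ℚ)
  set d' := (((2 * n - (j + 1)).choose n : ℕ) : ℚ)
  set e := (((2 * n - j).choose (n + k) : ℕ) : ℚ)
  set e' := (((2 * n - (j + 1)).choose (n + k) : ℕ) : ℚ)
  linear_combination (a * (c' * ((k : ℚ) + j + 1)) * (d' * (2 * (n : ℚ) - j)) * (e' * (2 * (n : ℚ) - j))) * hb +
    (a * (b * ((n : ℚ) - j)) * (d' * (2 * (n : ℚ) - j)) * (e' * (2 * (n : ℚ) - j))) * hc -
    (a * (b * ((n : ℚ) - j)) * (c * ((n : ℚ) - j)) * (e' * (2 * (n : ℚ) - j))) * hd -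
    (a * (b * ((n : ℚ) - j)) * (c * ((n : ℚ) - j)) * (d * ((n : ℚ) - j))) * he

/-- The coefficients of the common `k`-recurrence (content-free telescoper of certificates C1/C2):
`p₀ = (k−n)(k+n+1)³`, `p₁ = (k+1)·e₁(n,k)`, `p₂ = (k+1)(k+2)(k+n+2)²`. -/
def p₀ (n k : ℚ) : ℚ := (k - n) * (k + n + 1) ^ 3

/-- `p₁ = (k+1)·e₁(n,k)`, `e₁ = 2k³+4k²n+8k²+kn²+9kn+11k−2n³−2n²+4n+5` (the tree's `SymmetricRecursion.e₁`). -/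
def p₁ (n k : ℚ) : ℚ := (k + 1) * e₁ n k

/-- `p₂ = (k+1)(k+2)(k+n+2)²`. -/
def p₂ (n k : ℚ) : ℚ := (k + 1) * (k + 2) * (k + n + 2) ^ 2

/-- Certificate of (C1): `G_A(n,k,j) = j(n+1)(j−2n−1)²(k+n+1)/(j+k+1) · u(n,k,j)`. -/
def certA (n k j : ℕ) : ℚ :=
  (j : ℚ) * ((n : ℚ) + 1) * ((j : ℚ) - 2 * n - 1) ^ 2 * ((k : ℚ) + n + 1) / ((j : ℚ) + k + 1) * uTerm n k j

set_option maxRecDepth 100000 in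
/-- Termwise form of (C1): `p₀u(k,j) + p₁u(k+1,j) + p₂u(k+2,j) = G_A(j+1) − G_A(j)` (for `1 ≤ n`, `j ≤ n`). -/
theorem certA_term (n k j : ℕ) (hn : 1 ≤ n) (hj : j ≤ n) :
    p₀ n k * uTerm n k j + p₁ n k * uTerm n (k + 1) j + p₂ n k * uTerm n (k + 2) j =
      certA n k (j + 1) - certA n k j := by
  have hD1 : (((k : ℚ) + 1) * ((k : ℚ) + j + 1) * ((n : ℚ) + k + 1)) ≠ 0 := by positivity
  have hD2 : ((((k + 1 : ℕ) : ℚ) + 1) * (((k + 1 : ℕ) : ℚ) + j + 1) * ((n : ℚ) + ((k + 1 : ℕ) : ℚ) + 1)) ≠ 0 := by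
    positivity
  have h2n : (2 * (n : ℚ) - j) ≠ 0 := by
    have : (j : ℚ) ≤ n := by exact_mod_cast hj
    have : (1 : ℚ) ≤ n := by exact_mod_cast hn
    intro h; linarith
  have hD3 : (((j : ℚ) + 1) * ((k : ℚ) + j + 1) * (2 * (n : ℚ) - j) ^ 2) ≠ 0 := by
    have : ((j : ℚ) + 1) * ((k : ℚ) + j + 1) ≠ 0 := by positivity
    exact mul_ne_zero this (pow_ne_zero 2 h2n)
  have r1 : uTerm n (k + 1) j = uTerm n k j * ((((n : ℚ) + k + 1) ^ 2 * ((n : ℚ) - k - j)) /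
      (((k : ℚ) + 1) * ((k : ℚ) + j + 1) * ((n : ℚ) + k + 1))) := by
    rw [mul_div_assoc', eq_div_iff hD1]; exact uTerm_k_succ n k j (by omega)
  have r2 : uTerm n (k + 1 + 1) j = uTerm n (k + 1) j * ((((n : ℚ) + ((k + 1 : ℕ) : ℚ) + 1) ^ 2 *
      ((n : ℚ) - ((k + 1 : ℕ) : ℚ) - j)) / ((((k + 1 : ℕ) : ℚ) + 1) * (((k + 1 : ℕ) : ℚ) + j + 1) *
      ((n : ℚ) + ((k + 1 : ℕ) : ℚ) + 1))) := by
    rw [mul_div_assoc', eq_div_iff hD2]; exact uTerm_k_succ n (k + 1) j (by omega)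
  rw [show k + 2 = k + 1 + 1 from rfl]
  have r3 : uTerm n k (j + 1) = uTerm n k j * ((((n : ℚ) - j) ^ 3 * ((n : ℚ) - k - j)) /
      (((j : ℚ) + 1) * ((k : ℚ) + j + 1) * (2 * (n : ℚ) - j) ^ 2)) := by
    rw [mul_div_assoc', eq_div_iff hD3]; exact uTerm_j_succ n k j (by omega)
  unfold certA p₀ p₁ p₂ e₁
  rw [r2, r1, r3]
  push_cast
  have hd1 : ((j : ℚ) + k + 1) ≠ 0 := by positivity
  have hd2 : ((j : ℚ) + 1 + k + 1) ≠ 0 := by positivity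
  have hk1 : ((k : ℚ) + 1) ≠ 0 := by positivity
  have hk2 : ((k : ℚ) + 1 + 1) ≠ 0 := by positivity
  have hkj1 : ((k : ℚ) + j + 1) ≠ 0 := by positivity
  have hkj2 : ((k : ℚ) + 1 + j + 1) ≠ 0 := by positivity
  have hnk1 : ((n : ℚ) + k + 1) ≠ 0 := by positivity
  have hnk2 : ((n : ℚ) + (k + 1) + 1) ≠ 0 := by positivity
  have hj1 : ((j : ℚ) + 1) ≠ 0 := by positivity
  set w : ℚ := 2 * (n : ℚ) - j with hw
  field_simp
  rw [hw]
  ring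

/-- `G_A(n,k,0) = 0`. -/
theorem certA_zero (n k : ℕ) : certA n k 0 = 0 := by simp [certA]

/-- `u(n,k,n+1) = 0` (the factor `C(n,n+1)`), hence `G_A(n,k,n+1) = 0`. -/
theorem uTerm_succ_self (n k : ℕ) : uTerm n k (n + 1) = 0 := by
  simp [uTerm, Nat.choose_succ_self]

/-- **Recurrence for `U`** (certificate C1 summed over `j ≤ n`): `p₀U(k) + p₁U(k+1) + p₂U(k+2) = 0` for `n ≥ 1`. -/
theorem uSum_rec (n k : ℕ) (hn : 1 ≤ n) :
    p₀ n k * uSum n k + p₁ n k * uSum n (k + 1) + p₂ n k * uSum n (k + 2) = 0 := by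
  have hsum : p₀ n k * uSum n k + p₁ n k * uSum n (k + 1) + p₂ n k * uSum n (k + 2)
      = ∑ j ∈ range (n + 1), (certA n k (j + 1) - certA n k j) := by
    unfold uSum
    rw [Finset.mul_sum, Finset.mul_sum, Finset.mul_sum, ← Finset.sum_add_distrib, ← Finset.sum_add_distrib]
    exact Finset.sum_congr rfl fun j hj => certA_term n k j hn (Nat.lt_succ_iff.mp (Finset.mem_range.mp hj))
  rw [hsum, Finset.sum_range_sub, certA_zero, certA, uTerm_succ_self]
  simp

/-- `U(n,n+1+i) = 0`: every summand carries `C(2n−j, 2n+1+i) = 0`. -/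
theorem uSum_above (n i : ℕ) : uSum n (n + 1 + i) = 0 := by
  unfold uSum
  refine Finset.sum_eq_zero fun j _ => ?_
  unfold uTerm
  rw [Nat.choose_eq_zero_of_lt (by omega : 2 * n - j < n + (n + 1 + i))]
  simp

/-- The anchor on the `U` side: `U(n,n) = C(2n,n)³` (only `j = 0` survives). -/
theorem uSum_diag (n : ℕ) : uSum n n = ((((2 * n).choose n : ℕ) : ℚ)) ^ 3 := by
  unfold uSum
  rw [Finset.sum_eq_single 0]
  · unfold uTerm
    rw [show n + n = 2 * n by ring]
    simp only [Nat.add_zero, Nat.sub_zero, Nat.choose_zero_right, Nat.choose_self, Nat.cast_one]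
    ring
  · intro j hj hj0
    have hj' := Finset.mem_range.mp hj
    unfold uTerm
    rw [Nat.choose_eq_zero_of_lt (by omega : 2 * n - j < n + n)]
    simp
  · intro h; exact absurd (Finset.mem_range.mpr (by omega)) h

/-! ### The `V` side: `C(n,k)·T(n,k)` and the same recurrence from relation (K) -/

/-- `V(n,k) = C(n,k)·T(n,k)`, `T = SymmetricRecursion.innerT` (`= S_B(n,k)` as a rational). -/
def vVal (n k : ℕ) : ℚ := ((n.choose k : ℕ) : ℚ) * innerT n k

/-- **Recurrence for `V`**: `p₀V(k) + p₁V(k+1) + p₂V(k+2) = 0` — relation (K) times `(n−k)·C(n,k)`. -/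
theorem vVal_rec (n k : ℕ) : p₀ n k * vVal n k + p₁ n k * vVal n (k + 1) + p₂ n k * vVal n (k + 2) = 0 := by
  have hK := relK n k
  have E1 := choose_succ_right_cast n k
  have E2 := choose_succ_right_cast n (k + 1)
  unfold vVal p₀ p₁ p₂
  push_cast at E2 ⊢
  set c0 := ((n.choose k : ℕ) : ℚ)
  set c1 := ((n.choose (k + 1) : ℕ) : ℚ)
  set c2 := ((n.choose (k + 2) : ℕ) : ℚ)
  set T0 := innerT n k
  set T1 := innerT n (k + 1)
  set T2 := innerT n (k + 2)
  linear_combination ((n : ℚ) - k) * c0 * hK + e₁ n k * T1 * E1 +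
    ((k : ℚ) + n + 2) ^ 2 * T2 * (((k : ℚ) + 1) * E2 + ((n : ℚ) - k - 1) * E1)

/-- `V(n,n+1+i) = 0` (`C(n,n+1+i) = 0`). -/
theorem vVal_above (n i : ℕ) : vVal n (n + 1 + i) = 0 := by
  simp [vVal, Nat.choose_eq_zero_of_lt (by omega : n < n + 1 + i)]

end Summit.KontsevichZagierPeriods.Zeta5Search.DexactDiagonalWhipple
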